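import Summits.QuantumFields.BalabanUV.Beta.SecondOrderSocketIdentification

/-!
# `BalabanUV.Beta.BorderLetterPacking` — binder row D1, (L4)∕HR-W-LET, border sub-chain «BX2»: **THE PACKING ADAPTER FROM an1's
# (g,h)-SYMMETRISED BOND-LEVEL BORDER REFLECTION LAW TO THE hR END's PURE-SIGN BORDER STATEMENT `hInv`** for the candidate row table
# `vh₂SAn1` (β sub-cell, D1 formalisation swarm, leaf-05 gen 7; the border twin of MX2 `MixedLetterPacking`)

HONEST FRAMING (cell charter, verbatim): «discharging BetaPertH makes Balaban's UV stability UNCONDITIONAL — a real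
constructive-QFT result; it is NOT the continuum limit and NOT the Clay problem.»
HONEST DEPENDENCY: continuum YM on T⁴ ⇐ BetaPertH ∧ nine spine estimates (0/9 proved); BetaPertH ⇐ (D1) ∧ (D4) ∧ CAP+tail;
G-an2-4 gates asym, D1 and NE2/3/4.
DERIVED cell leaf ([folklore] kernel unfolding over node 7aρ∕12b `vhKerAt`∕`linKerAt`∕`vh2KerAt`∕`vhSAt`∕`vh₂SAt`, an5's `refK`∕`Φ`∕`mref`∕
`blk_mref`, an2's `actB`∕`bhKAt`∕`ctGen`∕`wallD₀`∕`Bwall`∕`Twall`∕`vh₂SAn1`, an3's `SpureRecAt_inl_inr`∕`gamma_zero`, all BY NAME).  CONDITIONAL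
WIRING: the bond-level border law `hB` below is a HYPOTHESIS — the (g,h)-SYMMETRISATION of an1-g28's RESULT «W-LET-S₂-BORDER-TOY» (journal
l.11788; operator form `ε_gε_h·refK_α(S_{ḡh̄}) = S_gh + conjW E V_g V_h X_g X_h (X_g∘X_h) + RB_gh` with `RB` (g,h)-ODD, toy-certified 0∕43 864
entries; NOT a theorem of the tree; the target normal form of the AVG-LETTERS chain's border modules) — and this file only REPACKS it: no
statement of Bałaban's papers, no `[cite:]`, no definition, no `Prop` fact.  It discharges NO letter and instantiates NO binder of the wall
(0∕4: hW, hR, D1Tel, D1Rep); the weight `cB = −Lc¹²∕4` below is DISPLAYED as the value at which the socket is met, NOT ruled (it is the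
lockB value `−cVH²∕Lc⁴` of an2's `SecondOrderLocks.lockB_iff` at `cVH = −Lc⁸∕2`, and an1-g28's ∕ beta-num-g38's toy constant `−L^{3D}∕4`;
(R45)∕(P6) stay with the leads).  NOT D1, NOT BetaPertH, NOT continuum, NOT Clay.

## What is here (`d + 1 = 4`, odd `Lc`, `ρ_c = toSite (ctrOff 4 Lc)`; block bond `b = (m, y)`, `y = blk Lc z`, fluctuation bond `f = (β, x)`,
## jet bonds `g = (κ, u)`, `h = (κ′, u′)`; `F_g(f) := [x = u ∧ β = κ ∧ κ = α]`, `Q_g(b) := [m = α]·linKerAt ρ_c Lc m y g`)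
* §1 entries on the field–multiplier block: `vhSAt_inl_inr'`, `vh₂SAn1_inl_inr`, `actB_vh₂SAn1_inl_inr` (the reflected symmetrised border table reads an1's
  `s_{b̃}(f̄; ḡ, h̄)` — `blk_mref`, `off_mref_eq_zero_iff`), `bhKAt_inl_inr_eq` (`bhKAt`'s border block is `−Lc⁴·linKerAt`), `wallD₀_inl_inr` (the
  wall contact's border entry is `−(Lc¹²∕4)·CONTACT`, `CONTACT := m_b(f,h)(Q_g − F_g) + m_b(f,g)(Q_h − F_h) + q_b(f)(Q_g − F_g)(Q_h − F_h)` —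
  `canonD_apply` with an2's pins `γ₀ = −Lc⁴∕2`, `cVH = −Lc⁸∕2`).
* §2 **`borderInv_of_bondLaw`**: the symmetrised bond law `hB` ⟹ K-N∕K-P's `hInv` —
  `∀ α κ u κ′ u′ x z β m, (actB Lc α (cB • vh₂SAn1 Lc − Twall Lc cΛ γ) − (cB • vh₂SAn1 Lc − Twall Lc cΛ γ)) κ u κ′ u′ x z (inl β) (inr m) = 0`
  AT **`cB = −Lc¹²∕4`**; **`borderAt_zero_of_bondLaw`**: hence `BorderAt Lc ρ_c cΛ (−Lc¹²∕4) γ (vh₂SAn1 Lc) 0` (K-N `borderAt_zero_an1_iff`).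
Provenance: β sub-cell, D1 formalisation swarm, unit b2b-balaban-beta-d1-formalise-leaf-05 gen 7, 2026-08-20 (v1); no existing file touched.
-/

open Finset
open scoped BigOperators
open Literature.MathematicalPhysics.QuantumFieldTheory
open Literature.MathematicalPhysics.QuantumFieldTheory.Balaban1983to89
open Literature.MathematicalPhysics.QuantumFieldTheory.Balaban1983to89.Beta
open ExpKernelCalculus (MKer)
open AffineAveraging (box toSite)
open AveragingContours (blk off)
open AveragingContoursRooted (ctr ctrOff ctrOff_mem_box linAvgAt)
open AveragingHessianKernels (Bond packVH packVH_inl_inr)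
open AveragingHessianKernelsRooted (vhKerAt linKerAt linCountAt vhSAt)
open AveragingMixedJetTables (vh2KerAt vh₂SAt)
open PolarizationSign (reflSign)
open KernelReflection (refK refK_apply)
open ResolventReflection (bref mref Φ Φ_r_inl Φ_r_inr Φ_s_inl Φ_s_inr)
open RootedKernelReflection (off_mref_eq_zero_iff blk_mref)
open KKTFluctuationKernel (delta1)
open OneStepResolventKernel (Fib)
open BalabanStepJetsSucc (wVH)
open Summit.QuantumFields.BalabanUV.Beta.TameKernelCalculus
open Summit.QuantumFields.BalabanUV.Beta.ChartConjugation (conjW)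
open Summit.QuantumFields.BalabanUV.Beta.BorderedHessian (diagK ctGen ctGen_inl ctGen_inr bhKAt bhKAt_inl_inr bhKStepAt bhKStepAt_zero stepScale
  off_eq_zero_iff_proj blk_eq_quo linAvgAt_delta1_eq_cast)
open Summit.QuantumFields.BalabanUV.Beta.SpineRooted (SpureRecAt)
open Summit.QuantumFields.BalabanUV.Beta.SecondOrderBorderGauge (actB actB_apply actB_sub actB_smul canonD canonD_apply)
open Summit.QuantumFields.BalabanUV.Beta.SecondOrderBorderGaugeWall (wallD₀)
open Summit.QuantumFields.BalabanUV.Beta.SecondOrderBorderCocycle (bdB_inl_inr)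
open Summit.QuantumFields.BalabanUV.Beta.SecondOrderBorderModel (Bwall Twall Twall_solves)
open Summit.QuantumFields.BalabanUV.Beta.SecondOrderLetterLevels (BorderAt SpureRecAt_inl_inr gamma_zero)
open Summit.QuantumFields.BalabanUV.Beta.SecondOrderSocketIdentification (atw vh₂SAn1 borderAt_zero_an1_iff)

namespace Summit.QuantumFields.BalabanUV.Beta.BorderLetterPacking

noncomputable section

variable {Lc : ℕ} [NeZero Lc]

/-! ## §1 Entries on the field–multiplier block -/

omit [NeZero Lc] in
/-- [folklore] The field–multiplier entry of the first-order border table `vhSAt`: `[off z = 0]·m_{(m, blk z)}((β,x), (κ,u))`. -/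
theorem vhSAt_inl_inr' (ρ : Fin 4 → ℤ) (κ : Fin 4) (u x z : Fin 4 → ℤ) (β m : Fin 4) :
    vhSAt ρ 3 Lc rfl κ u x z (Sum.inl β) (Sum.inr m) = if off Lc z = 0 then vhKerAt ρ Lc m (blk Lc z) (β, x) (κ, u) else 0 := by
  unfold vhSAt
  rw [packVH_inl_inr]

omit [NeZero Lc] in
/-- [folklore] The field–multiplier entry of the candidate row table: `[off z = 0]·½(s_b(f; g, h) + s_b(f; h, g))`. -/
theorem vh₂SAn1_inl_inr (κ : Fin 4) (u : Fin 4 → ℤ) (κ' : Fin 4) (u' x z : Fin 4 → ℤ) (β m : Fin 4) :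
    vh₂SAn1 Lc κ u κ' u' x z (Sum.inl β) (Sum.inr m) =
      if off Lc z = 0 then (1 / 2 : ℝ) * (vh2KerAt (toSite (ctrOff 4 Lc)) Lc m (blk Lc z) (β, x) (κ, u) (κ', u')
        + vh2KerAt (toSite (ctrOff 4 Lc)) Lc m (blk Lc z) (β, x) (κ', u') (κ, u)) else 0 := by
  show ((1 / 2 : ℝ) • (vh₂SAt (toSite (ctrOff 4 Lc)) Lc κ u κ' u' + vh₂SAt (toSite (ctrOff 4 Lc)) Lc κ' u' κ u)) x z (Sum.inl β) (Sum.inr m) = _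
  rw [Pi.smul_apply, Pi.smul_apply, Pi.smul_apply, Pi.smul_apply, Pi.add_apply, Pi.add_apply, Pi.add_apply, Pi.add_apply, smul_eq_mul]
  unfold vh₂SAt
  rw [packVH_inl_inr, packVH_inl_inr]
  split_ifs <;> ring

omit [NeZero Lc] in
/-- [folklore] **THE REFLECTED CANDIDATE ON THE FIELD–MULTIPLIER BLOCK READS an1's `s_{b̃}(f̄; ḡ, h̄)`** (symmetrised): the multiplier leg moves by
`mref` (offset zero preserved, block index reflected by `bref α m`), the field leg and the jet bonds by `bref`, signs `ε_κ ε_κ′ ε_β ε_m`. -/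
theorem actB_vh₂SAn1_inl_inr (hLc : Odd Lc) (α κ : Fin 4) (u : Fin 4 → ℤ) (κ' : Fin 4) (u' x z : Fin 4 → ℤ) (β m : Fin 4) :
    actB Lc α (vh₂SAn1 Lc) κ u κ' u' x z (Sum.inl β) (Sum.inr m) =
      if off Lc z = 0 then reflSign α κ * reflSign α κ' * (reflSign α β * reflSign α m *
        ((1 / 2 : ℝ) * (vh2KerAt (toSite (ctrOff 4 Lc)) Lc m (bref α m (blk Lc z)) (β, bref α β x) (κ, bref α κ u) (κ', bref α κ' u')
          + vh2KerAt (toSite (ctrOff 4 Lc)) Lc m (bref α m (blk Lc z)) (β, bref α β x) (κ', bref α κ' u') (κ, bref α κ u)))) else 0 := by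
  rw [actB_apply, Φ_s_inl, Φ_s_inr, Φ_r_inl, Φ_r_inr, vh₂SAn1_inl_inr]
  by_cases hz : off Lc z = 0
  · rw [if_pos ((off_mref_eq_zero_iff hLc.pos α m z).2 hz), if_pos hz, blk_mref hLc.pos α m hz]
  · rw [if_neg (fun h => hz ((off_mref_eq_zero_iff hLc.pos α m z).1 h)), if_neg hz]
    ring

/-- [folklore] **THE BORDER BLOCK OF THE ROOTED BORDERED HESSIAN IS `−Lc⁴·q`**: `bhKAt 3 ρ_c Lc x z (inl β) (inr m) = −[off z = 0]·Lc⁴·linKerAt ρ_c Lc m (blk z) (β, x)`. -/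
theorem bhKAt_inl_inr_eq (x z : Fin 4 → ℤ) (β m : Fin 4) :
    bhKAt 3 (toSite (ctrOff 4 Lc)) Lc x z (Sum.inl β) (Sum.inr m) =
      if off Lc z = 0 then -((Lc : ℝ) ^ 4 * linKerAt (toSite (ctrOff 4 Lc)) Lc m (blk Lc z) (β, x)) else 0 := by
  have hL : (Lc : ℝ) ≠ 0 := by exact_mod_cast NeZero.ne Lc
  rw [bhKAt_inl_inr]
  by_cases hz : off Lc z = 0
  · rw [if_pos ((off_eq_zero_iff_proj z).1 hz), if_pos hz, linAvgAt_delta1_eq_cast, blk_eq_quo]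
    unfold linKerAt
    field_simp
  · rw [if_neg (fun h => hz ((off_eq_zero_iff_proj z).2 h)), if_neg hz]

open Classical in
/-- [folklore] **THE WALL's LEVEL-0 BORDER CONTACT ON THE FIELD–MULTIPLIER BLOCK** in bond language (`canonD_apply`; an3's
`SpureRecAt_inl_inr`, `gamma_zero`; the three pins combine to the common factor `−Lc¹²∕4`):
`wallD₀ … α κ u κ′ u′ x z (inl β) (inr m) = −[off z = 0]·(Lc¹²∕4)·(m_b(f,h)(Q_g − F_g) + m_b(f,g)(Q_h − F_h) + q_b(f)(Q_g − F_g)(Q_h − F_h))`. -/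
theorem wallD₀_inl_inr (cΛ : ℝ) (γ : ℕ → ℝ) (hγ : ∀ j, γ j = -((Lc : ℝ) ^ 8 / 2) * wVH 3 Lc j / (stepScale 3 Lc j * (Lc : ℝ) ^ 4))
    (α κ : Fin 4) (u : Fin 4 → ℤ) (κ' : Fin 4) (u' x z : Fin 4 → ℤ) (β m : Fin 4) :
    wallD₀ Lc cΛ γ α κ u κ' u' x z (Sum.inl β) (Sum.inr m) =
      if off Lc z = 0 then
        -((Lc : ℝ) ^ 12 / 4) *
          (vhKerAt (toSite (ctrOff 4 Lc)) Lc m (blk Lc z) (β, x) (κ', u')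
              * ((if m = α then linKerAt (toSite (ctrOff 4 Lc)) Lc m (blk Lc z) (κ, u) else 0) - (if x = u ∧ β = κ ∧ κ = α then 1 else 0))
            + vhKerAt (toSite (ctrOff 4 Lc)) Lc m (blk Lc z) (β, x) (κ, u)
              * ((if m = α then linKerAt (toSite (ctrOff 4 Lc)) Lc m (blk Lc z) (κ', u') else 0) - (if x = u' ∧ β = κ' ∧ κ' = α then 1 else 0))
            + linKerAt (toSite (ctrOff 4 Lc)) Lc m (blk Lc z) (β, x)
              * ((if m = α then linKerAt (toSite (ctrOff 4 Lc)) Lc m (blk Lc z) (κ, u) else 0) - (if x = u ∧ β = κ ∧ κ = α then 1 else 0))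
              * ((if m = α then linKerAt (toSite (ctrOff 4 Lc)) Lc m (blk Lc z) (κ', u') else 0) - (if x = u' ∧ β = κ' ∧ κ' = α then 1 else 0)))
      else 0 := by
  have h0 := gamma_zero (Lc := Lc) hγ
  unfold wallD₀
  rw [canonD_apply, SpureRecAt_inl_inr, SpureRecAt_inl_inr, bhKStepAt_zero, bhKAt_inl_inr_eq, vhSAt_inl_inr', vhSAt_inl_inr',
    ctGen_inr, ctGen_inr, ctGen_inl, ctGen_inl, h0]
  have hw : wVH 3 Lc 0 = 1 := by simp [BalabanStepJetsSucc.wVH]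
  rw [hw]
  have hc : ctr 4 Lc = toSite (ctrOff 4 Lc) := rfl
  simp only [hc]
  by_cases hz : off Lc z = 0
  · simp only [hz, if_true, and_true]
    split_ifs <;> ring
  · simp only [hz, if_false, and_false]
    ring

/-! ## §2 The pure-sign border statement from the bond law -/

open Classical in
/-- [folklore] **an1's SYMMETRISED BOND-LEVEL BORDER LAW ⟹ THE hR END's PURE-SIGN BORDER STATEMENT `hInv`** (K-N `borderAt_zero_an1_iff` ∕
K-P `…_of_tableLaw_an1` ∕ K-Q `symmetries_JsRowD1_of_letters`, token for token) AT THE WEIGHT `cB = −Lc¹²∕4` (displayed, not ruled).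
HYPOTHESIS `hB` (for all `α m y β x κ u κ′ u′`; `x̄ = bref α β x` etc., `ỹ = bref α m y`):
`ε_β ε_κ ε_κ′ ε_m · (s_{(m,ỹ)}((β,x̄); (κ,ū), (κ′,ū′)) + s_{(m,ỹ)}((β,x̄); (κ′,ū′), (κ,ū)))
  = (s_{(m,y)}((β,x); (κ,u), (κ′,u′)) + s_{(m,y)}((β,x); (κ′,u′), (κ,u))) + 2·CONTACT`. -/
theorem borderInv_of_bondLaw (hLc : Odd Lc) (cΛ : ℝ) (γ : ℕ → ℝ)
    (hγ : ∀ j, γ j = -((Lc : ℝ) ^ 8 / 2) * wVH 3 Lc j / (stepScale 3 Lc j * (Lc : ℝ) ^ 4))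
    (hB : ∀ (α m : Fin 4) (y : Fin 4 → ℤ) (β : Fin 4) (x : Fin 4 → ℤ) (κ : Fin 4) (u : Fin 4 → ℤ) (κ' : Fin 4) (u' : Fin 4 → ℤ),
      reflSign α β * reflSign α κ * reflSign α κ' * reflSign α m *
          (vh2KerAt (toSite (ctrOff 4 Lc)) Lc m (bref α m y) (β, bref α β x) (κ, bref α κ u) (κ', bref α κ' u')
            + vh2KerAt (toSite (ctrOff 4 Lc)) Lc m (bref α m y) (β, bref α β x) (κ', bref α κ' u') (κ, bref α κ u))
        = (vh2KerAt (toSite (ctrOff 4 Lc)) Lc m y (β, x) (κ, u) (κ', u') + vh2KerAt (toSite (ctrOff 4 Lc)) Lc m y (β, x) (κ', u') (κ, u))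
          + 2 * (vhKerAt (toSite (ctrOff 4 Lc)) Lc m y (β, x) (κ', u')
                  * ((if m = α then linKerAt (toSite (ctrOff 4 Lc)) Lc m y (κ, u) else 0) - (if x = u ∧ β = κ ∧ κ = α then 1 else 0))
                + vhKerAt (toSite (ctrOff 4 Lc)) Lc m y (β, x) (κ, u)
                  * ((if m = α then linKerAt (toSite (ctrOff 4 Lc)) Lc m y (κ', u') else 0) - (if x = u' ∧ β = κ' ∧ κ' = α then 1 else 0))
                + linKerAt (toSite (ctrOff 4 Lc)) Lc m y (β, x)
                  * ((if m = α then linKerAt (toSite (ctrOff 4 Lc)) Lc m y (κ, u) else 0) - (if x = u ∧ β = κ ∧ κ = α then 1 else 0))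
                  * ((if m = α then linKerAt (toSite (ctrOff 4 Lc)) Lc m y (κ', u') else 0) - (if x = u' ∧ β = κ' ∧ κ' = α then 1 else 0)))) :
    ∀ (α κ : Fin 4) (u : Fin 4 → ℤ) (κ' : Fin 4) (u' x z : Fin 4 → ℤ) (β m : Fin 4),
      (actB Lc α ((-((Lc : ℝ) ^ 12 / 4)) • vh₂SAn1 Lc - Twall Lc cΛ γ) - ((-((Lc : ℝ) ^ 12 / 4)) • vh₂SAn1 Lc - Twall Lc cΛ γ))
        κ u κ' u' x z (Sum.inl β) (Sum.inr m) = 0 := by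
  intro α κ u κ' u' x z β m
  -- split off the model: `actB_α Twall − Twall = Bwall α`, whose border entry is the wall contact's
  have hT := congrFun (congrFun (congrFun (congrFun (Twall_solves hLc cΛ γ hγ α) κ) u) κ') u'
  have hTe := congrArg (fun K : MKer 4 (Fib 3) => K x z (Sum.inl β) (Sum.inr m)) hT
  simp only [Pi.sub_apply] at hTe
  have hBw : Bwall Lc cΛ γ α κ u κ' u' x z (Sum.inl β) (Sum.inr m) = wallD₀ Lc cΛ γ α κ u κ' u' x z (Sum.inl β) (Sum.inr m) :=
    bdB_inl_inr _ κ u κ' u' x z β m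
  rw [hBw, wallD₀_inl_inr cΛ γ hγ] at hTe
  rw [actB_sub, actB_smul]
  simp only [Pi.sub_apply, Pi.smul_apply, smul_eq_mul]
  rw [actB_vh₂SAn1_inl_inr hLc, vh₂SAn1_inl_inr]
  by_cases hz : off Lc z = 0
  · simp only [hz, if_true] at hTe ⊢
    have key := hB α m (blk Lc z) β x κ u κ' u'
    linear_combination (-((Lc : ℝ) ^ 12 / 4) * (1 / 2 : ℝ)) * key - hTe
  · simp only [hz, if_false] at hTe ⊢
    linear_combination -hTe

open Classical in
/-- [folklore] **HENCE THE hR END's BORDER LETTER AT LEVEL `0` FOR THE CANDIDATE** `vh₂SAn1` at `cB = −Lc¹²∕4` (K-N `borderAt_zero_an1_iff`). -/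
theorem borderAt_zero_of_bondLaw (hLc : Odd Lc) (cΛ : ℝ) (γ : ℕ → ℝ)
    (hγ : ∀ j, γ j = -((Lc : ℝ) ^ 8 / 2) * wVH 3 Lc j / (stepScale 3 Lc j * (Lc : ℝ) ^ 4))
    (hB : ∀ (α m : Fin 4) (y : Fin 4 → ℤ) (β : Fin 4) (x : Fin 4 → ℤ) (κ : Fin 4) (u : Fin 4 → ℤ) (κ' : Fin 4) (u' : Fin 4 → ℤ),
      reflSign α β * reflSign α κ * reflSign α κ' * reflSign α m *
          (vh2KerAt (toSite (ctrOff 4 Lc)) Lc m (bref α m y) (β, bref α β x) (κ, bref α κ u) (κ', bref α κ' u')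
            + vh2KerAt (toSite (ctrOff 4 Lc)) Lc m (bref α m y) (β, bref α β x) (κ', bref α κ' u') (κ, bref α κ u))
        = (vh2KerAt (toSite (ctrOff 4 Lc)) Lc m y (β, x) (κ, u) (κ', u') + vh2KerAt (toSite (ctrOff 4 Lc)) Lc m y (β, x) (κ', u') (κ, u))
          + 2 * (vhKerAt (toSite (ctrOff 4 Lc)) Lc m y (β, x) (κ', u')
                  * ((if m = α then linKerAt (toSite (ctrOff 4 Lc)) Lc m y (κ, u) else 0) - (if x = u ∧ β = κ ∧ κ = α then 1 else 0))
                + vhKerAt (toSite (ctrOff 4 Lc)) Lc m y (β, x) (κ, u)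
                  * ((if m = α then linKerAt (toSite (ctrOff 4 Lc)) Lc m y (κ', u') else 0) - (if x = u' ∧ β = κ' ∧ κ' = α then 1 else 0))
                + linKerAt (toSite (ctrOff 4 Lc)) Lc m y (β, x)
                  * ((if m = α then linKerAt (toSite (ctrOff 4 Lc)) Lc m y (κ, u) else 0) - (if x = u ∧ β = κ ∧ κ = α then 1 else 0))
                  * ((if m = α then linKerAt (toSite (ctrOff 4 Lc)) Lc m y (κ', u') else 0) - (if x = u' ∧ β = κ' ∧ κ' = α then 1 else 0)))) :
    BorderAt Lc (toSite (ctrOff 4 Lc)) cΛ (-((Lc : ℝ) ^ 12 / 4)) γ (vh₂SAn1 Lc) 0 :=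
  (borderAt_zero_an1_iff hLc cΛ (-((Lc : ℝ) ^ 12 / 4)) γ hγ).2 (borderInv_of_bondLaw hLc cΛ γ hγ hB)

end

end Summit.QuantumFields.BalabanUV.Beta.BorderLetterPacking
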